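import Summits.PneNP.PneNP.Theorems.KrwChromaticSteeringStrongCompositionLrxDefs
import Summits.PneNP.PneNP.Theorems.KrwChromaticSteeringStrongCompositionLrbQuantitative

/-!
# Crux line `lrx-gluing` (stmt-PneNP-18538), the glued adversary on `LRX_t` I: padding, decoupling trees, THE TYPE-A STEP
# (the two registered stubs `stub_crossingAlice` / `stub_crossingBob`, PROVED)

The one new step of the `LRX_t` adversary relative to the PROVED rung C1|LRB (`KrwChromaticSteeringStrongCompositionLrb*.lean`): an
affine test THROUGH combinatorial rows (a type-A node of crossing weight `w = affWeight U τ ≥ 1`).  The glued LRAD invariant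
`KrwLrad.InvAt` (potential `ℓ + min K k ≤ depth + 2`) is kept VERBATIM and no new adversary state is introduced (skeleton
`Cruxes/StrongComposition/Lines/lrx_gluing.lean` §3–§5, CLOSED, crux write dae79b7d2e87; memo `Cruxes/StrongComposition/LensBarrierP4g20.md`
§3 ¶1 / §3.5 «eager decoupling pays `w + 1` per type-A node»):

* §1 PADDING (`KrwLrx.pad` of `…LrxDefs.lean`): `pad t N` plays like `N` and is `t` deeper, so «potential `≤ depth N + 2 + t`» is
  literally `InvAt g q τ (pad t N)`; and `InvAt` sees a tree only through its play function and (monotonically) its depth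
  (`invAt_of_run_depth`).
* §2 DECOUPLING TREES (`KrwLrx.decoupleA/B`, `KrwLrx.strip`, `KrwLrx.combRows`): the decoupling tree of the affine test
  `c ⊕ parityOn U` along rows `i₁ … i_w` — single-row PARITY tests on these rows, then on each of the `2^w` branches the affine test on
  the stripped support with the constant corrected by the branch — has the node's play function (`run_decoupleA/B`, by
  `KrwLrb.parityOn_split`) and depth `+ w` (`depth_decoupleA/B`); when the listed rows are combinatorial and contain every
  combinatorial row of `U`, the invariant on it follows from the LANDED LRAD step lemmas alone — `row_stepAt_*` once per listed row
  (the typing does not move) and `affine_stepAt_*` on the stripped support, which avoids combinatorial rows (`invAt_decoupleA/B`);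
  `retag (strip …) ∘ proj = proj ∘ retagX U` (`retag_strip_eq_proj_retagX`).
* §3 THE TYPE-A STEP `crossingStep_alice/bob`, and the line's two REGISTERED STUBS `stub_crossingAlice : CrossingStepAlice`,
  `stub_crossingBob : CrossingStepBob` (statements in `…LrxDefs.lean`, verbatim the skeleton) — PROVED.

FRONTIER rung of the KRW programme (class-restricted, budget-relaxed strong composition, Meir 2023); the `t`-free LRA bound and C1
itself stay open; nothing here bears on P vs NP.
-/

set_option linter.dupNamespace false -- `Summit.PneNP.PneNP.…`: summit = sub-problem name (D-0017 single-conjunct layout)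
set_option autoImplicit false

namespace Summit.PneNP.PneNP.Theorems.KrwLrx

open Literature.Computability.Complexity
open Summit.PneNP.PneNP.Theorems.KrwLrad
open Summit.PneNP.PneNP.Theorems.KrwLrb

universe u

/-! ## §1  Padding -/

section Padding

variable {m n : ℕ} {g : (Fin n → Bool) → Bool} {q : ℕ}


/-- Padding does not change the play. -/
@[simp] theorem run_pad {ι : Type u} : ∀ (t : ℕ) (N : KWTree ι) (a b : ι → Bool), (pad t N).run a b = N.run a b
  | 0, _, _, _ => rfl
  | t + 1, N, a, b => by simp only [pad, KWTree.run_alice, run_pad t N a b, ite_self]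

/-- Padding adds `t` to the depth. -/
@[simp] theorem depth_pad {ι : Type u} : ∀ (t : ℕ) (N : KWTree ι), (pad t N).depth = N.depth + t
  | 0, _ => rfl
  | t + 1, N => by simp only [pad, KWTree.depth_alice, depth_pad t N, max_self]; omega

/-- **`InvAt` sees a tree only through its play function and (monotonically) its depth.** -/
theorem invAt_of_run_depth {τ : Fin m → RowType} {N N' : KWTree (Fin m × Fin n)}
    (hrun : ∀ X Y, N'.run X Y = N.run X Y) (hd : N.depth ≤ N'.depth) (h : InvAt g q τ N) :
    InvAt g q τ N' := by
  intro A B S T E k hst hsat hload hV hD hneA hneB ℓ K r hL hR hK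
  have hV' : ValidOnE g N A B S T E := by
    intro X hX Y hY
    have h1 := hV X hX Y hY
    rwa [hrun X Y] at h1
  have := h A B S T E k hst hsat hload hV' hD hneA hneB ℓ K r hL hR hK
  omega

/-- Depth bookkeeping of a padded Alice node: children padded by `t − w`, plus the `w` extra rounds, is the node padded by `t`. -/
theorem depth_alice_pad_add {ι : Type u} (s : (ι → Bool) → Bool) (P Q : KWTree ι) {t w : ℕ} (hw : w ≤ t) :
    (KWTree.alice s (pad (t - w) P) (pad (t - w) Q)).depth + w = (pad t (KWTree.alice s P Q)).depth := by
  simp only [KWTree.depth_alice, depth_pad]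
  rw [max_add_add_right]
  omega

/-- Depth bookkeeping of a padded Bob node. -/
theorem depth_bob_pad_add {ι : Type u} (s : (ι → Bool) → Bool) (P Q : KWTree ι) {t w : ℕ} (hw : w ≤ t) :
    (KWTree.bob s (pad (t - w) P) (pad (t - w) Q)).depth + w = (pad t (KWTree.bob s P Q)).depth := by
  simp only [KWTree.depth_bob, depth_pad]
  rw [max_add_add_right]
  omega

end Padding

/-! ## §2  Decoupling trees -/

section Decoupling

variable {m n : ℕ} {g : (Fin n → Bool) → Bool} {q : ℕ}


/-- Membership in a stripped support. -/
theorem mem_strip : ∀ (rows : List (Fin m)) (U : Finset (Fin m × Fin n)) (p : Fin m × Fin n),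
    p ∈ strip rows U ↔ p ∈ U ∧ p.1 ∉ rows
  | [], U, p => by simp [strip]
  | i :: rows, U, p => by
    rw [strip, mem_strip rows (offRow U i) p]
    simp only [offRow, Finset.mem_filter, List.mem_cons, not_or]
    tauto

/-- The rows a stripped support touches. -/
theorem mem_touchedRows_strip (rows : List (Fin m)) (U : Finset (Fin m × Fin n)) (i : Fin m) :
    i ∈ touchedRows (strip rows U) ↔ i ∈ eqRows U ∧ i ∉ rows := by
  simp only [touchedRows, eqRows, Finset.mem_image, mem_strip, Prod.exists, exists_and_right, exists_eq_right]



/-- The decoupling tree plays exactly like the affine node (`parityOn_split` along the listed rows). -/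
theorem run_decoupleA (P Q : KWTree (Fin m × Fin n)) :
    ∀ (rows : List (Fin m)) (U : Finset (Fin m × Fin n)) (c : Bool) (X Y : Fin m × Fin n → Bool),
      (decoupleA P Q rows U c).run X Y = if Bool.xor c (parityOn U X) then Q.run X Y else P.run X Y
  | [], _, _, _, _ => rfl
  | i :: rows, U, c, X, Y => by
    simp only [decoupleA, KWTree.run_alice, run_decoupleA P Q rows]
    rw [parityOn_split U X i]
    cases rowParity (rowSupp U i) (row X i) <;> cases c <;> cases parityOn (offRow U i) X <;> rfl

/-- Bob's decoupling tree plays exactly like the affine node. -/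
theorem run_decoupleB (P Q : KWTree (Fin m × Fin n)) :
    ∀ (rows : List (Fin m)) (U : Finset (Fin m × Fin n)) (c : Bool) (X Y : Fin m × Fin n → Bool),
      (decoupleB P Q rows U c).run X Y = if Bool.xor c (parityOn U Y) then Q.run X Y else P.run X Y
  | [], _, _, _, _ => rfl
  | i :: rows, U, c, X, Y => by
    simp only [decoupleB, KWTree.run_bob, run_decoupleB P Q rows]
    rw [parityOn_split U Y i]
    cases rowParity (rowSupp U i) (row Y i) <;> cases c <;> cases parityOn (offRow U i) Y <;> rfl

/-- Depth of Alice's decoupling tree: the node's depth plus one round per listed row. -/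
theorem depth_decoupleA (P Q : KWTree (Fin m × Fin n)) :
    ∀ (rows : List (Fin m)) (U : Finset (Fin m × Fin n)) (c : Bool),
      (decoupleA P Q rows U c).depth = max P.depth Q.depth + 1 + rows.length
  | [], _, _ => rfl
  | i :: rows, U, c => by
    simp only [decoupleA, KWTree.depth_alice, depth_decoupleA P Q rows, max_self, List.length_cons]
    omega

/-- Depth of Bob's decoupling tree. -/
theorem depth_decoupleB (P Q : KWTree (Fin m × Fin n)) :
    ∀ (rows : List (Fin m)) (U : Finset (Fin m × Fin n)) (c : Bool),
      (decoupleB P Q rows U c).depth = max P.depth Q.depth + 1 + rows.length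
  | [], _, _ => rfl
  | i :: rows, U, c => by
    simp only [decoupleB, KWTree.depth_bob, depth_decoupleB P Q rows, max_self, List.length_cons]
    omega

/-- **The invariant on Alice's decoupling tree**, from the landed LRAD step lemmas alone: `row_stepAt_alice` once per listed
(combinatorial) row — the typing does not move — then `affine_stepAt_alice` on the stripped support, which avoids combinatorial
rows. -/
theorem invAt_decoupleA (hLU : PerRowLU g m q) (i₀ : Fin m) (j₀ : Fin n) (τ : Fin m → RowType)
    {P Q : KWTree (Fin m × Fin n)} :
    ∀ (rows : List (Fin m)) (U : Finset (Fin m × Fin n)) (c : Bool),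
      (∀ i ∈ rows, τ i = RowType.combinatorial) →
      (∀ i ∈ touchedRows (strip rows U), τ i ≠ RowType.combinatorial) →
      InvAt g q (retag (strip rows U) τ) P → InvAt g q (retag (strip rows U) τ) Q →
      InvAt g q τ (decoupleA P Q rows U c)
  | [], U, c, _, hU, hIP, hIQ =>
    affine_stepAt_alice hLU (s := fun X => Bool.xor c (parityOn U X)) (fun _ => rfl) hU hIP hIQ
  | i :: rows, U, c, hrows, hU, hIP, hIQ => by
    have hτi : τ i = RowType.combinatorial := hrows i List.mem_cons_self
    have hrows' : ∀ i' ∈ rows, τ i' = RowType.combinatorial := fun i' hi' => hrows i' (List.mem_cons_of_mem i hi')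
    have h0 := invAt_decoupleA hLU i₀ j₀ τ rows (offRow U i) c hrows' hU hIP hIQ
    have h1 := invAt_decoupleA hLU i₀ j₀ τ rows (offRow U i) (!c) hrows' hU hIP hIQ
    have hup : Function.update τ i RowType.combinatorial = τ := Function.update_eq_self_iff.2 hτi.symm
    refine row_stepAt_alice i₀ j₀ (i := i) (ψ := rowParity (rowSupp U i)) (fun _ => rfl) ?_ ?_ ?_
    · rw [hτi]; exact fun h => RowType.noConfusion h
    · rw [hup]; exact h0
    · rw [hup]; exact h1

/-- **The invariant on Bob's decoupling tree** (mirror image). -/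
theorem invAt_decoupleB (hLU : PerRowLU g m q) (i₀ : Fin m) (j₀ : Fin n) (τ : Fin m → RowType)
    {P Q : KWTree (Fin m × Fin n)} :
    ∀ (rows : List (Fin m)) (U : Finset (Fin m × Fin n)) (c : Bool),
      (∀ i ∈ rows, τ i = RowType.combinatorial) →
      (∀ i ∈ touchedRows (strip rows U), τ i ≠ RowType.combinatorial) →
      InvAt g q (retag (strip rows U) τ) P → InvAt g q (retag (strip rows U) τ) Q →
      InvAt g q τ (decoupleB P Q rows U c)
  | [], U, c, _, hU, hIP, hIQ =>
    affine_stepAt_bob hLU (s := fun Y => Bool.xor c (parityOn U Y)) (fun _ => rfl) hU hIP hIQ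
  | i :: rows, U, c, hrows, hU, hIP, hIQ => by
    have hτi : τ i = RowType.combinatorial := hrows i List.mem_cons_self
    have hrows' : ∀ i' ∈ rows, τ i' = RowType.combinatorial := fun i' hi' => hrows i' (List.mem_cons_of_mem i hi')
    have h0 := invAt_decoupleB hLU i₀ j₀ τ rows (offRow U i) c hrows' hU hIP hIQ
    have h1 := invAt_decoupleB hLU i₀ j₀ τ rows (offRow U i) (!c) hrows' hU hIP hIQ
    have hup : Function.update τ i RowType.combinatorial = τ := Function.update_eq_self_iff.2 hτi.symm
    refine row_stepAt_bob i₀ j₀ (i := i) (ψ := rowParity (rowSupp U i)) (fun _ => rfl) ?_ ?_ ?_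
    · rw [hτi]; exact fun h => RowType.noConfusion h
    · rw [hup]; exact h0
    · rw [hup]; exact h1


/-- Membership in the list of crossed combinatorial rows. -/
theorem mem_combRows {U : Finset (Fin m × Fin n)} {τ : Fin m → RowTypeX} {i : Fin m} :
    i ∈ combRows U τ ↔ i ∈ eqRows U ∧ τ i = RowTypeX.combinatorial := by
  simp [combRows]

/-- The list of crossed combinatorial rows has length the crossing weight `affWeight U τ`. -/
theorem length_combRows (U : Finset (Fin m × Fin n)) (τ : Fin m → RowTypeX) :
    (combRows U τ).length = affWeight U τ := by
  simp [combRows, affWeight, Finset.length_toList]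

/-- Every listed row is combinatorial (in the LRAD projection of the typing). -/
theorem proj_of_mem_combRows {U : Finset (Fin m × Fin n)} {τ : Fin m → RowTypeX} :
    ∀ i ∈ combRows U τ, (τ i).proj = RowType.combinatorial := by
  intro i hi
  rw [(mem_combRows.1 hi).2]
  rfl

/-- The stripped support avoids combinatorial rows. -/
theorem proj_ne_of_touched_strip {U : Finset (Fin m × Fin n)} {τ : Fin m → RowTypeX} :
    ∀ i ∈ touchedRows (strip (combRows U τ) U), (τ i).proj ≠ RowType.combinatorial := by
  intro i hi hc
  rw [mem_touchedRows_strip, mem_combRows] at hi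
  exact hi.2 ⟨hi.1, (proj_eq_combinatorial_iff _).1 hc⟩

/-- **Retyping commutes with forgetting loads** at a type-A node: LRAD-retyping the projected typing by the STRIPPED support is
the projection of the LRX-retyping by the full support (combinatorial rows stay combinatorial on both sides). -/
theorem retag_strip_eq_proj_retagX (U : Finset (Fin m × Fin n)) (τ : Fin m → RowTypeX) :
    retag (strip (combRows U τ) U) (fun i => (τ i).proj) = fun i => (retagX U τ i).proj := by
  funext i
  by_cases h1 : i ∈ eqRows U
  · by_cases h2 : τ i = RowTypeX.combinatorial
    · have hni : i ∉ touchedRows (strip (combRows U τ) U) := by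
        rw [mem_touchedRows_strip, mem_combRows]; exact fun h => h.2 ⟨h1, h2⟩
      simp [retag, retagX, hni, h1, h2, RowTypeX.proj]
    · have hi : i ∈ touchedRows (strip (combRows U τ) U) := by
        rw [mem_touchedRows_strip, mem_combRows]; exact ⟨h1, fun h => h2 h.2⟩
      simp [retag, retagX, hi, h1, h2, RowTypeX.proj]
  · have hni : i ∉ touchedRows (strip (combRows U τ) U) := by
      rw [mem_touchedRows_strip]; exact fun h => h1 h.1
    simp [retag, retagX, hni, h1]

end Decoupling

/-! ## §3  The type-A step PROVED (`crossingStep_alice/bob`) and the two REGISTERED STUBS closed by it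

At an affine test of crossing weight `w = affWeight U τ`, the invariant of the two subtrees at the retyped typing gives the
invariant of ANY tree `N` playing like the node and at least `w` deeper — the «one unit per combinatorial row crossed» of the eager
decoupling — by the decoupling trees of §4.  The registered stubs `stub_crossingAlice : CrossingStepAlice` /
`stub_crossingBob : CrossingStepBob` (§2b) are these lemmas with explicit binders. -/

section Stubs

variable {m n : ℕ} {g : (Fin n → Bool) → Bool} {q : ℕ}

/-- **The type-A step, Alice.**  For an Alice affine test `s = c ⊕ parityOn U` at the LRX typing `τ`: if both subtrees satisfy the
glued LRAD invariant `InvAt` at the projection of the retyped typing `retagX U τ`, then every tree `N` with the node's play function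
and depth `≥ depth (alice s P Q) + affWeight U τ` satisfies `InvAt` at the projection of `τ`.  Proof: transport (`invAt_of_run_depth`)
from Alice's decoupling tree along the listed combinatorial rows `combRows U τ` (`invAt_decoupleA`, `run_decoupleA`,
`depth_decoupleA`, `retag_strip_eq_proj_retagX`). -/
theorem crossingStep_alice (hLU : PerRowLU g m q) (i₀ : Fin m) (j₀ : Fin n) {τ : Fin m → RowTypeX}
    {s : (Fin m × Fin n → Bool) → Bool} {P Q N : KWTree (Fin m × Fin n)} {U : Finset (Fin m × Fin n)} {c : Bool}
    (hs : ∀ X, s X = Bool.xor c (parityOn U X))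
    (hIP : InvAt g q (fun i => (retagX U τ i).proj) P) (hIQ : InvAt g q (fun i => (retagX U τ i).proj) Q)
    (hrun : ∀ X Y, N.run X Y = (KWTree.alice s P Q).run X Y)
    (hdepth : (KWTree.alice s P Q).depth + affWeight U τ ≤ N.depth) :
    InvAt g q (fun i => (τ i).proj) N := by
  rw [← retag_strip_eq_proj_retagX U τ] at hIP hIQ
  have hV := invAt_decoupleA hLU i₀ j₀ (fun i => (τ i).proj) (combRows U τ) U c
    proj_of_mem_combRows proj_ne_of_touched_strip hIP hIQ
  refine invAt_of_run_depth (fun X Y => ?_) ?_ hV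
  · rw [hrun, run_decoupleA, KWTree.run_alice, hs X]
  · rw [depth_decoupleA, length_combRows]
    simpa only [KWTree.depth_alice] using hdepth

/-- **The type-A step, Bob** (mirror image of `crossingStep_alice`). -/
theorem crossingStep_bob (hLU : PerRowLU g m q) (i₀ : Fin m) (j₀ : Fin n) {τ : Fin m → RowTypeX}
    {s : (Fin m × Fin n → Bool) → Bool} {P Q N : KWTree (Fin m × Fin n)} {U : Finset (Fin m × Fin n)} {c : Bool}
    (hs : ∀ Y, s Y = Bool.xor c (parityOn U Y))
    (hIP : InvAt g q (fun i => (retagX U τ i).proj) P) (hIQ : InvAt g q (fun i => (retagX U τ i).proj) Q)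
    (hrun : ∀ X Y, N.run X Y = (KWTree.bob s P Q).run X Y)
    (hdepth : (KWTree.bob s P Q).depth + affWeight U τ ≤ N.depth) :
    InvAt g q (fun i => (τ i).proj) N := by
  rw [← retag_strip_eq_proj_retagX U τ] at hIP hIQ
  have hV := invAt_decoupleB hLU i₀ j₀ (fun i => (τ i).proj) (combRows U τ) U c
    proj_of_mem_combRows proj_ne_of_touched_strip hIP hIQ
  refine invAt_of_run_depth (fun X Y => ?_) ?_ hV
  · rw [hrun, run_decoupleB, KWTree.run_bob, hs Y]
  · rw [depth_decoupleB, length_combRows]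
    simpa only [KWTree.depth_bob] using hdepth

/-- **STUB A (registered): the type-A step, Alice — PROVED** (`crossingStep_alice`). -/
theorem stub_crossingAlice : CrossingStepAlice :=
  fun _ _ _ _ hLU i₀ j₀ _ _ _ _ _ _ _ hs hIP hIQ hrun hdepth => crossingStep_alice hLU i₀ j₀ hs hIP hIQ hrun hdepth

/-- **STUB B (registered): the type-A step, Bob — PROVED** (`crossingStep_bob`). -/
theorem stub_crossingBob : CrossingStepBob :=
  fun _ _ _ _ hLU i₀ j₀ _ _ _ _ _ _ _ hs hIP hIQ hrun hdepth => crossingStep_bob hLU i₀ j₀ hs hIP hIQ hrun hdepth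

end Stubs
end Summit.PneNP.PneNP.Theorems.KrwLrx
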